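import Summits.ResolutionOfSingularities.ResolutionOfSingularities.Theorems.AbhyankarShadowsShadowsUniformizeRegularCentreTransfer
import Summits.ResolutionOfSingularities.ResolutionOfSingularities.Theorems.AbhyankarShadowsShadowsUniformizePlaneRegularCentre
import Summits.ResolutionOfSingularities.ResolutionOfSingularities.Theorems.AbhyankarShadowsShadowsUniformizeRuledRegularCentre
import HarnessLib

/-!
# Relative local uniformization from one regular centre of dimension ≤ 2, and for `k(x, y)` along every valuation: the regular-centre branch of `ShadowsUniformize`

Regular-centre branch of the birth line of the crux `ShadowsUniformize` (route `AbhyankarShadows`,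
item stmt-ResolutionOfSingularities-16756), lead c3 (reshape #5): the typed assemblies
`lurel_of_hasRegularCentreDimLeTwo`, `lurel_purelyTranscendental_two` and `lurel_ruled`.

**Theorem A (transfer from absolute to relative local uniformization in dimension two).** Let
`k ⊆ K` be fields, `O` a valuation ring of `K`, and suppose SOME finitely generated `B ⊆ O` with
`Frac B = K` has a regular local ring of Krull dimension `≤ 2` at the centre `𝔪_O ∩ B`. Then
EVERY finitely generated `R ⊆ O` is dominated by a finitely generated `A ⊆ O` with `Frac A = K`
which is regular at the centre of `O`. (Any ground field, any residue field, any value group.)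

**Theorem B (Zariski's local uniformization of the plane along an arbitrary valuation, all
characteristics, relative form).** For any field `k`, `K = k(x, y)` with `x, y` algebraically
independent, every valuation ring `O ∋ k` of `K` and every finitely generated `R ⊆ O`: some
finitely generated `A` with `R ≤ A ⊆ O`, `Frac A = K`, is regular at the centre of `O`.

Proofs: Theorem A is `stub_lurel_of_regularCentre` (landed): in dimension `≤ 1` the valuation
ring IS the regular local ring at the centre; in dimension `2` the quadratic transforms of the
centre's local ring along `O` exhaust `O` (Abhyankar 1956, Lemma 12, PROVED in the tree as
`AbhyankarQuadraticUnion_holds`), so the generators of `R` lie in the `N`-th transform, which is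
regular (Abhyankar 1956, Prop. 8, `isRegularLocalRing_sequence`) and is the local ring at the
centre of a finitely generated `B[t] ⊆ O`. Theorem B adds `stub_regularCentre_of_purelyTranscendental`
(landed): `k[x', y'] ⊆ O` with `x' ∈ {x, x⁻¹}`, `y' ∈ {y, y⁻¹}` is a polynomial ring, regular
of dimension `2`. **Theorem C (ruled surfaces)**: the same for `K = F(x)`, `trdeg_k F ≤ 1`, via
`stub_regularCentre_of_ruled` (landed): `A₁[x^{±1}]` over a model `A₁ ⊆ O ∩ F` of the curve `F`
regular at the centre (local uniformization in dimension one = finite normalization). In the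
crux these settle the sixth proved locus `HasRegularCentreDimLeTwo` —
in transcendence degree `2` exactly the valuations admitting absolute local uniformization on
one model; what remains of the surface case of the crux is absolute local uniformization of
surfaces in positive characteristic (Abhyankar 1956, Thm. 1), not in the tree.

## Sources

* S. S. Abhyankar, *On the valuations centered in a local domain*, Amer. J. Math. 78 (1956)
  321–348: Lemma 12, Prop. 8 (as quoted by Cutkosky 2014, Lemma 2.2). [Abhyankar1956Valuations]
* O. Zariski, *The reduction of the singularities of an algebraic surface*, Ann. of Math. 40
  (1939) 639–689 (local uniformization of surfaces in characteristic zero). [context]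
-/

noncomputable section

-- single-problem summit: the doubled namespace component is forced
set_option linter.dupNamespace false

open Literature.AlgebraicGeometry.Resolution IsLocalRing

namespace Summit.ResolutionOfSingularities.ResolutionOfSingularities.Theorems

/-- **Relative local uniformization from one regular centre of dimension `≤ 2`** (typed, in the
vocabulary of the crux `ShadowsUniformize` / the target `LurelRational`, but for ANY fields
`k ⊆ K` and ANY valuation ring): if some finitely generated `B ⊆ O` with `Frac B = K` is regular
of Krull dimension `≤ 2` at the centre of `O`, then every finitely generated `R ⊆ O` is dominated
by a finitely generated `A ⊆ O`, `Frac A = K`, regular at the centre of `O`.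
[cite: Abhyankar1956Valuations, Lemma 12] -/
theorem lurel_of_hasRegularCentreDimLeTwo (k K : Type) [Field k] [Field K] [Algebra k K]
    (O : ValuationSubring K)
    (hG : ∃ (B : Subalgebra k K) (h : B.toSubring ≤ O.toSubring), B.FG ∧ IsFractionRing B K ∧
      IsRegularLocalRing
        (Localization.AtPrime (Ideal.comap (Subring.inclusion h) (IsLocalRing.maximalIdeal O))) ∧
      ringKrullDim
        (Localization.AtPrime (Ideal.comap (Subring.inclusion h) (IsLocalRing.maximalIdeal O))) ≤ 2)
    (R : Subalgebra k K) (hR : R.FG) (hRO : R.toSubring ≤ O.toSubring) :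
    ∃ (A : Subalgebra k K) (h : A.toSubring ≤ O.toSubring), R ≤ A ∧ A.FG ∧
      IsFractionRing A K ∧ IsRegularLocalRing
        (Localization.AtPrime (Ideal.comap (Subring.inclusion h) (IsLocalRing.maximalIdeal O))) := by
  obtain ⟨B, hBO, hBfg, hfrac, hreg, hdim⟩ := hG
  exact stub_lurel_of_regularCentre k K O B hBfg hBO hfrac hreg hdim R hR hRO

/-- **Local uniformization of the plane along every valuation, relative form** (Zariski 1939 in
characteristic zero; here for ANY field `k` and EVERY valuation ring `O ∋ k` of `k(x, y)`): for
`K = k(x, y)` with `x, y` algebraically independent over `k`, every finitely generated `R ⊆ O` is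
dominated by a finitely generated `A ⊆ O` with `Frac A = K` which is regular at the centre of
`O`. In particular the route target `LurelRational` and the crux `ShadowsUniformize` hold for the
rational function field in two variables. [cite: Abhyankar1956Valuations, Lemma 12] -/
theorem lurel_purelyTranscendental_two (k K : Type) [Field k] [Field K] [Algebra k K] (x y : K)
    (hxy : AlgebraicIndependent k ![x, y]) (hgen : IntermediateField.adjoin k {x, y} = ⊤)
    (O : ValuationSubring K) (hk : ∀ c : k, algebraMap k K c ∈ O)
    (R : Subalgebra k K) (hR : R.FG) (hRO : R.toSubring ≤ O.toSubring) :
    ∃ (A : Subalgebra k K) (h : A.toSubring ≤ O.toSubring), R ≤ A ∧ A.FG ∧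
      IsFractionRing A K ∧ IsRegularLocalRing
        (Localization.AtPrime (Ideal.comap (Subring.inclusion h) (IsLocalRing.maximalIdeal O))) := by
  obtain ⟨B, hBO, hBfg, hfrac, hreg, hdim⟩ :=
    stub_regularCentre_of_purelyTranscendental k K x y hxy hgen O hk
  exact stub_lurel_of_regularCentre k K O B hBfg hBO hfrac hreg hdim R hR hRO

/-- **Relative local uniformization for ruled surfaces** (typed): for any field `k`, `K = F(x)`
with `F/k` finitely generated of transcendence degree `≤ 1` and `x` transcendental over `F`,
EVERY valuation ring `O ∋ k` of `K` and every finitely generated `R ⊆ O` admit a finitely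
generated `A` with `R ≤ A ⊆ O`, `Frac A = K`, regular at the centre of `O`
(`stub_regularCentre_of_ruled`: the model `A₁[x^{±1}]` over a model `A₁` of the curve `F`
regular at the centre, then the transfer `stub_lurel_of_regularCentre`). In particular the
route target `LurelRational` and the crux `ShadowsUniformize` hold for every birationally
ruled surface presented as `F(x)`. [cite: Abhyankar1956Valuations, Lemma 12] -/
theorem lurel_ruled (k K : Type) [Field k] [Field K] [Algebra k K] (F : IntermediateField k K)
    (hF : F.FG) (hF1 : Algebra.trdeg k F ≤ 1) (x : K) (hx : Transcendental F x)
    (hgen : IntermediateField.adjoin F {x} = ⊤) (O : ValuationSubring K)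
    (hk : ∀ c : k, algebraMap k K c ∈ O) (R : Subalgebra k K) (hR : R.FG)
    (hRO : R.toSubring ≤ O.toSubring) :
    ∃ (A : Subalgebra k K) (h : A.toSubring ≤ O.toSubring), R ≤ A ∧ A.FG ∧
      IsFractionRing A K ∧ IsRegularLocalRing
        (Localization.AtPrime (Ideal.comap (Subring.inclusion h) (IsLocalRing.maximalIdeal O))) := by
  obtain ⟨B, hBO, hBfg, hfrac, hreg, hdim⟩ :=
    stub_regularCentre_of_ruled k K F hF hF1 x hx hgen O hk
  exact stub_lurel_of_regularCentre k K O B hBfg hBO hfrac hreg hdim R hR hRO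

end Summit.ResolutionOfSingularities.ResolutionOfSingularities.Theorems

end
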